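import Mathlib
import HarnessLib
import Summits.Ventures.LatticeQCDFlow.Scoring.MarkovChainCLT
import Summits.Ventures.LatticeQCDFlow.Scoring.RegenerativeVarianceStrongLaw
import Summits.Ventures.LatticeQCDFlow.Scoring.RegenerativeCLTStudentized

/-!
# The studentised Markov-chain CLT: the τ_int error bar COMPUTED FROM THE SAME RUN is
# asymptotically exact — `√n (f̄_n − π f) / σ̂_n ⇒ N(0, 1)` with `σ̂²_n` the tour estimator

HONEST FRAMING: exact (Metropolis-corrected) sampling algorithms for lattice gauge theory;
figures of merit are autocorrelation/cost numbers at stated couplings and volumes; no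
continuum-physics claim.

Setting of `MarkovChainCLT`: `κ` Markov on `Ω` with invariant probability `π` and the whole-space
minorisation `κ(x, ·) ≥ ε ν` (`0 < ε < 1`), `κs` its split kernel, `P̂` the split chain's path law
from ANY initial law `μs`; `|f| ≤ C` measurable, `σ²_f` the Green–Kubo (integrated-autocorrelation)
variance, ASSUMED `> 0`.  Along the run `x_0, …, x_{n−1}` (states AND regeneration coins) let
`K_{n−1}` be the number of regenerations so far and `R_n := K_{n−1} − 1` the number of COMPLETED
tours `1, …, R_n`; from those tours alone form the regenerative variance estimator
`σ̂²_n := V̂_{R_n} / N̄_{R_n}` (`V̂_R = (1/R) Σ_{i<R} (Y_{i+1} − Â_R N_{i+1})²`, `N̄_R` the mean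
tour length) — a statistic of the observed path only.

* `splitChain_sigmaHat_strongLaw` — `σ̂²_n → σ²_f` almost surely (from
  `regenerative_sigma_strongLaw` and `K_{n−1} → ∞` a.s.).
* `splitChain_timeAverage_studentized_clt` — **`√n (f̄_n − π f) / σ̂_n ⇒ N(0, 1)`**, i.e.
  `TendstoInDistribution (fun n x => ((√n)⁻¹ Σ_{t<n} (f x_t − πf)) / √σ̂²_n(x)) atTop Y P̂` for
  `Y ~ N(0, 1)`: the time-average CLT (`splitChain_timeAverage_clt`), the strong consistency of
  `σ̂²_n`, Slutsky (`(a, w) ↦ a / √(max(w, σ²/4))`) and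
  `tendstoInDistribution_of_tendstoInMeasure_sub`.
* `splitChain_timeAverage_studentized_coverage` — for `z > 0`,
  `P̂(|√n (f̄_n − πf)| ≤ z σ̂_n) → (gaussianReal 0 1)[−z, z]`: the interval `f̄_n ± z σ̂_n / √n`
  computed from the run alone covers `π f` with asymptotically exact nominal probability.

NOT CLAIMED: a rate; the degenerate case `σ²_f = 0`; unbounded `f`; an estimator of `σ²_f` that
does not use the regeneration coins (batch means / spectral); any `ε` of a concrete sampler.
-/

noncomputable section

namespace Summit.Ventures.LatticeQCDFlow.Scoring

open MeasureTheory ProbabilityTheory Filter Finset Preorder Literature.Probability.MarkovChains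
open scoped ENNReal Topology

section StudentizedTimeAverage

variable {Ω : Type*} [MeasurableSpace Ω]
  {κ : Kernel Ω Ω} [IsMarkovKernel κ] {ν : Measure Ω} [IsProbabilityMeasure ν] {ε : ℝ≥0∞}
  {hmin : ∀ x {B : Set Ω}, MeasurableSet B → ε * ν B ≤ κ x B}
  (κs : Kernel (Ω × Bool) (Ω × Bool)) [IsMarkovKernel κs]
  (μs : Measure (Ω × Bool)) [IsProbabilityMeasure μs]

omit [MeasurableSpace Ω] in
/-- A family of measurable maps evaluated at a measurable `ℕ`-valued random index is measurable. -/
private theorem measurable_natIndex {X : Type*} [MeasurableSpace X] {F : ℕ → X → ℝ}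
    (hF : ∀ k, Measurable (F k)) {R : X → ℕ} (hR : Measurable R) :
    Measurable fun x => F (R x) x := by
  intro s hs
  have : (fun x => F (R x) x) ⁻¹' s = ⋃ k : ℕ, R ⁻¹' {k} ∩ (F k) ⁻¹' s := by
    ext x
    simp only [Set.mem_preimage, Set.mem_iUnion, Set.mem_inter_iff, Set.mem_singleton_iff]
    constructor
    · intro h
      exact ⟨R x, rfl, h⟩
    · rintro ⟨k, hk, h⟩
      rw [hk]
      exact h
  rw [this]
  exact MeasurableSet.iUnion fun k => (hR (measurableSet_singleton k)).inter (hF k hs)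

/-- **THE RUN'S OWN VARIANCE ESTIMATE IS STRONGLY CONSISTENT**: with `R_n = K_{n−1} − 1` completed
tours, `σ̂²_n = V̂_{R_n} / N̄_{R_n} → σ²_f` almost surely, from any initial law. -/
theorem splitChain_sigmaHat_strongLaw {π : Measure Ω} [IsProbabilityMeasure π]
    (hπ : Kernel.Invariant κ π) (hε0 : 0 < ε) (hε : ε < 1)
    (hκs : ∀ p, κs p = (ε • ν).map (fun y : Ω => (y, true))
      + ((1 - ε) • Doeblin.residualKernel κ ν ε hmin p.1).map (fun y : Ω => (y, false)))
    {f : Ω → ℝ} (hf : Measurable f) {C : ℝ} (hC : ∀ x, |f x| ≤ C) :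
    ∀ᵐ x ∂(Kernel.trajMeasure (X := fun _ : ℕ => Ω × Bool) μs
        (fun m : ℕ => κs.comap (fun h : (i : ↥(Finset.Iic m)) → Ω × Bool =>
          h ⟨m, Finset.mem_Iic.2 le_rfl⟩) (measurable_pi_apply _))),
      Tendsto (fun n : ℕ => (((∑ i ∈ Finset.range (((∑ s ∈ Finset.range (n - 1), (if (x (s + 1)).2 then (1 : ℕ) else 0)) - 1 : ℕ)), ((∑' u, (if (∑ s ∈ Finset.range u, (if (x (s + 1)).2 then (1 : ℕ) else 0)) = i + 1 then (1 : ℝ) else 0) * f (x u).1) - ((∑ i ∈ Finset.range (((∑ s ∈ Finset.range (n - 1), (if (x (s + 1)).2 then (1 : ℕ) else 0)) - 1 : ℕ)), (∑' u, (if (∑ s ∈ Finset.range u, (if (x (s + 1)).2 then (1 : ℕ) else 0)) = i + 1 then (1 : ℝ) else 0) * f (x u).1)) / (∑ i ∈ Finset.range (((∑ s ∈ Finset.range (n - 1), (if (x (s + 1)).2 then (1 : ℕ) else 0)) - 1 : ℕ)), (∑' u, (if (∑ s ∈ Finset.range u, (if (x (s + 1)).2 then (1 : ℕ) else 0)) =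 i + 1 then (1 : ℝ) else 0)))) * (∑' u, (if (∑ s ∈ Finset.range u, (if (x (s + 1)).2 then (1 : ℕ) else 0)) = i + 1 then (1 : ℝ) else 0))) ^ 2) / (((∑ s ∈ Finset.range (n - 1), (if (x (s + 1)).2 then (1 : ℕ) else 0)) - 1 : ℕ))) / ((∑ i ∈ Finset.range (((∑ s ∈ Finset.range (n - 1), (if (x (s + 1)).2 then (1 : ℕ) else 0)) - 1 : ℕ)), (∑' u, (if (∑ s ∈ Finset.range u, (if (x (s + 1)).2 then (1 : ℕ) else 0)) = i + 1 then (1 : ℝ) else 0))) / (((∑ s ∈ Finset.range (n - 1), (if (x (s + 1)).2 then (1 : ℕ) else 0)) - 1 : ℕ))))) atTop (𝓝 ((∫ y, (f y - ∫ z, f z ∂π) ^ 2 ∂π)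
      + 2 * ∑' k, ∫ y, (f y - ∫ z, f z ∂π) * (kop κ)^[k + 1] (fun y => f y - ∫ z, f z ∂π) y ∂π)) := by
  filter_upwards [regenerative_sigma_strongLaw κs μs (κ := κ) (ν := ν) (hmin := hmin) hπ hε0 hε hκs
    hf hC, splitChain_ae_tourStart κs μs (κ := κ) (ν := ν) (hmin := hmin) hε0 hε hκs] with x hV hx
  have hK : Tendsto (fun n : ℕ => (((∑ s ∈ Finset.range (n - 1), (if (x (s + 1)).2 then (1 : ℕ) else 0)) - 1 : ℕ))) atTop atTop := by
    refine tendsto_atTop_atTop.2 fun k => ?_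
    obtain ⟨t, ht, hht⟩ := hx (k + 1)
    refine ⟨t + 2, fun n hn => ?_⟩
    have h1 := headCount_mono x (show t + 1 ≤ n - 1 by omega)
    rw [headCount_succ, ht, hht] at h1
    simp only [if_true] at h1
    omega
  exact hV.comp hK

/-- **THE STUDENTISED MARKOV-CHAIN CLT.**  `σ²_f > 0`; for `Y ~ N(0, 1)`:
`((√n)⁻¹ Σ_{t<n} (f(x_t) − π f)) / σ̂_n ⇒ Y` under the split chain's path law from any start. -/
theorem splitChain_timeAverage_studentized_clt {π : Measure Ω} [IsProbabilityMeasure π]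
    (hπ : Kernel.Invariant κ π) (hε0 : 0 < ε) (hε : ε < 1)
    (hκs : ∀ p, κs p = (ε • ν).map (fun y : Ω => (y, true))
      + ((1 - ε) • Doeblin.residualKernel κ ν ε hmin p.1).map (fun y : Ω => (y, false)))
    {f : Ω → ℝ} (hf : Measurable f) {C : ℝ} (hC : ∀ x, |f x| ≤ C)
    (hσ : 0 < ((∫ y, (f y - ∫ z, f z ∂π) ^ 2 ∂π)
      + 2 * ∑' k, ∫ y, (f y - ∫ z, f z ∂π) * (kop κ)^[k + 1] (fun y => f y - ∫ z, f z ∂π) y ∂π))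
    {Ω' : Type*} [MeasurableSpace Ω'] {P' : Measure Ω'} [IsProbabilityMeasure P'] {Y : Ω' → ℝ}
    (hY : HasLaw Y (gaussianReal 0 1) P')
    [IsProbabilityMeasure (Kernel.trajMeasure (X := fun _ : ℕ => Ω × Bool) μs
        (fun m : ℕ => κs.comap (fun h : (i : ↥(Finset.Iic m)) → Ω × Bool =>
          h ⟨m, Finset.mem_Iic.2 le_rfl⟩) (measurable_pi_apply _)))] :
    TendstoInDistribution (fun (n : ℕ) (x : ℕ → Ω × Bool) =>
        ((Real.sqrt n)⁻¹ * ∑ t ∈ Finset.range n, (f (x t).1 - ∫ z, f z ∂π)) / Real.sqrt (((∑ i ∈ Finset.range (((∑ s ∈ Finset.range (n - 1), (if (x (s + 1)).2 then (1 : ℕ) else 0)) - 1 : ℕ)), ((∑' u, (if (∑ s ∈ Finset.range u, (if (x (s + 1)).2 then (1 : ℕ) else 0)) = i + 1 then (1 : ℝ) else 0) * f (x u).1) - ((∑ i ∈ Finset.range (((∑ s ∈ Finset.range (n - 1), (if (x (s + 1)).2 then (1 : ℕ) else 0)) - 1 : ℕ)), (∑' u, (if (∑ s ∈ Finset.range u,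 (if (x (s + 1)).2 then (1 : ℕ) else 0)) = i + 1 then (1 : ℝ) else 0) * f (x u).1)) / (∑ i ∈ Finset.range (((∑ s ∈ Finset.range (n - 1), (if (x (s + 1)).2 then (1 : ℕ) else 0)) - 1 : ℕ)), (∑' u, (if (∑ s ∈ Finset.range u, (if (x (s + 1)).2 then (1 : ℕ) else 0)) = i + 1 then (1 : ℝ) else 0)))) * (∑' u, (if (∑ s ∈ Finset.range u, (if (x (s + 1)).2 then (1 : ℕ) else 0)) = i + 1 then (1 : ℝ) else 0))) ^ 2) / (((∑ s ∈ Finset.range (n - 1), (if (x (s + 1)).2 then (1 : ℕ) else 0)) - 1 : ℕ))) / ((∑ i ∈ Finset.range (((∑ s ∈ Finset.range (n - 1), (if (x (s + 1)).2 then (1 : ℕ) else 0)) - 1 : ℕ)), (∑' u, (if (∑ s ∈ Finset.range u, (if (x (s + 1)).2 then (1 : ℕ) else 0)) = i + 1 then (1 : ℝ) else 0))) / (((∑ s ∈ Finset.range (n - 1), (if (x (s + 1)).2 then (1 : ℕ) else 0)) - 1 : ℕ)))))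
      atTop Y (fun _ => (Kernel.trajMeasure (X := fun _ : ℕ => Ω × Bool) μs
        (fun m : ℕ => κs.comap (fun h : (i : ↥(Finset.Iic m)) → Ω × Bool =>
          h ⟨m, Finset.mem_Iic.2 le_rfl⟩) (measurable_pi_apply _)))) P' := by
  set P := (Kernel.trajMeasure (X := fun _ : ℕ => Ω × Bool) μs
        (fun m : ℕ => κs.comap (fun h : (i : ↥(Finset.Iic m)) → Ω × Bool =>
          h ⟨m, Finset.mem_Iic.2 le_rfl⟩) (measurable_pi_apply _))) with hP
  set c := ∫ z, f z ∂π with hc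
  set σ2 := ((∫ y, (f y - ∫ z, f z ∂π) ^ 2 ∂π)
      + 2 * ∑' k, ∫ y, (f y - ∫ z, f z ∂π) * (kop κ)^[k + 1] (fun y => f y - ∫ z, f z ∂π) y ∂π) with hσ2
  have hsv : Real.sqrt σ2 ≠ 0 := (Real.sqrt_pos.2 hσ).ne'
  obtain ⟨hg, -, -⟩ := centred_observable_bounds π hf hC
  -- measurability of the pieces
  have hYm : ∀ i : ℕ, Measurable fun x : ℕ → Ω × Bool => (∑' u, (if (∑ s ∈ Finset.range u, (if (x (s + 1)).2 then (1 : ℕ) else 0)) = i + 1 then (1 : ℝ) else 0) * f (x u).1) := fun i =>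
    measurable_tourSum (Ω := Ω) (ψ := fun p _ => f p.1) (hf.comp (measurable_fst.comp measurable_fst))
      (i + 1)
  have hNm : ∀ i : ℕ, Measurable fun x : ℕ → Ω × Bool => (∑' u, (if (∑ s ∈ Finset.range u, (if (x (s + 1)).2 then (1 : ℕ) else 0)) = i + 1 then (1 : ℝ) else 0)) := fun i =>
    Measurable.tsum fun u => measurable_headCountIndicator u (i + 1)
  have hSHm : ∀ R : ℕ, Measurable fun x : ℕ → Ω × Bool => (((∑ i ∈ Finset.range R, ((∑' u, (if (∑ s ∈ Finset.range u, (if (x (s + 1)).2 then (1 : ℕ) else 0)) = i + 1 then (1 : ℝ) else 0) * f (x u).1) - ((∑ i ∈ Finset.range R, (∑' u, (if (∑ s ∈ Finset.range u, (if (x (s + 1)).2 then (1 : ℕ) else 0)) = i + 1 then (1 : ℝ) else 0) * f (x u).1)) / (∑ i ∈ Finset.range R, (∑' u, (if (∑ s ∈ Finset.range u, (if (x (s + 1)).2 then (1 : ℕ) else 0)) = i + 1 then (1 : ℝ) else 0)))) * (∑' u, (if (∑ s ∈ Finset.range u, (if (x (s + 1)).2 then (1 : ℕ) else 0)) = i +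 1 then (1 : ℝ) else 0))) ^ 2) / R) / ((∑ i ∈ Finset.range R, (∑' u, (if (∑ s ∈ Finset.range u, (if (x (s + 1)).2 then (1 : ℕ) else 0)) = i + 1 then (1 : ℝ) else 0))) / R)) := by
    intro R
    have hSYm : Measurable fun x : ℕ → Ω × Bool => (∑ i ∈ Finset.range R, (∑' u, (if (∑ s ∈ Finset.range u, (if (x (s + 1)).2 then (1 : ℕ) else 0)) = i + 1 then (1 : ℝ) else 0) * f (x u).1)) :=
      Finset.measurable_sum _ fun i _ => hYm i
    have hSNm : Measurable fun x : ℕ → Ω × Bool => (∑ i ∈ Finset.range R, (∑' u, (if (∑ s ∈ Finset.range u, (if (x (s + 1)).2 then (1 : ℕ) else 0)) = i + 1 then (1 : ℝ) else 0))) :=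
      Finset.measurable_sum _ fun i _ => hNm i
    exact ((Finset.measurable_sum _ fun i _ =>
      ((hYm i).sub ((hSYm.div hSNm).mul (hNm i))).pow_const 2).div_const _).div (hSNm.div_const _)
  have hRm : ∀ n : ℕ, Measurable fun x : ℕ → Ω × Bool => (((∑ s ∈ Finset.range (n - 1), (if (x (s + 1)).2 then (1 : ℕ) else 0)) - 1 : ℕ)) := fun n =>
    (measurable_from_nat (f := fun k : ℕ => k - 1)).comp (measurable_headCount (n - 1))
  have hSigm : ∀ n : ℕ, Measurable fun x : ℕ → Ω × Bool => (((∑ i ∈ Finset.range (((∑ s ∈ Finset.range (n - 1), (if (x (s + 1)).2 then (1 : ℕ) else 0)) - 1 : ℕ)), ((∑' u, (if (∑ s ∈ Finset.range u, (if (x (s + 1)).2 then (1 : ℕ) else 0)) = i + 1 then (1 : ℝ) else 0) * f (x u).1) - ((∑ i ∈ Finset.range (((∑ s ∈ Finset.range (n - 1), (if (x (s + 1)).2 then (1 : ℕ) else 0)) - 1 : ℕ)), (∑' u, (if (∑ s ∈ Finset.range u, (if (x (s + 1)).2 then (1 : ℕ) else 0)) = i + 1 then (1 : ℝ) else 0)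 * f (x u).1)) / (∑ i ∈ Finset.range (((∑ s ∈ Finset.range (n - 1), (if (x (s + 1)).2 then (1 : ℕ) else 0)) - 1 : ℕ)), (∑' u, (if (∑ s ∈ Finset.range u, (if (x (s + 1)).2 then (1 : ℕ) else 0)) = i + 1 then (1 : ℝ) else 0)))) * (∑' u, (if (∑ s ∈ Finset.range u, (if (x (s + 1)).2 then (1 : ℕ) else 0)) = i + 1 then (1 : ℝ) else 0))) ^ 2) / (((∑ s ∈ Finset.range (n - 1), (if (x (s + 1)).2 then (1 : ℕ) else 0)) - 1 : ℕ))) / ((∑ i ∈ Finset.range (((∑ s ∈ Finset.range (n - 1), (if (x (s + 1)).2 then (1 : ℕ) else 0)) - 1 : ℕ)), (∑' u, (if (∑ s ∈ Finset.range u, (if (x (s + 1)).2 then (1 : ℕ) else 0)) = i + 1 then (1 : ℝ) else 0))) / (((∑ s ∈ Finset.range (n - 1), (if (x (s + 1)).2 then (1 : ℕ) else 0)) - 1 : ℕ)))) := fun n =>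
    measurable_natIndex (F := fun (R : ℕ) (x : ℕ → Ω × Bool) => (((∑ i ∈ Finset.range R, ((∑' u, (if (∑ s ∈ Finset.range u, (if (x (s + 1)).2 then (1 : ℕ) else 0)) = i + 1 then (1 : ℝ) else 0) * f (x u).1) - ((∑ i ∈ Finset.range R, (∑' u, (if (∑ s ∈ Finset.range u, (if (x (s + 1)).2 then (1 : ℕ) else 0)) = i + 1 then (1 : ℝ) else 0) * f (x u).1)) / (∑ i ∈ Finset.range R, (∑' u, (if (∑ s ∈ Finset.range u, (if (x (s + 1)).2 then (1 : ℕ) else 0)) = i + 1 then (1 : ℝ) else 0)))) * (∑' u, (if (∑ s ∈ Finset.range u, (if (x (s + 1)).2 then (1 : ℕ) else 0)) = i + 1 then (1 : ℝ) else 0))) ^ 2) / R) / ((∑ i ∈ Finset.range R, (∑' u, (if (∑ s ∈ Finset.range u, (if (x (s + 1)).2 then (1 : ℕ) else 0)) = i + 1 then (1 : ℝ) else 0))) / R))) hSHm (hRm n)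
  have hAm : ∀ n : ℕ, Measurable fun x : ℕ → Ω × Bool => ((Real.sqrt n)⁻¹ * ∑ t ∈ Finset.range n, (f (x t).1 - ∫ z, f z ∂π)) := fun n =>
    measurable_const.mul (Finset.measurable_sum _ fun t _ =>
      hg.comp (measurable_fst.comp (measurable_pi_apply t)))
  have hTm : ∀ n : ℕ, Measurable fun x : ℕ → Ω × Bool => ((Real.sqrt n)⁻¹ * ∑ t ∈ Finset.range n, (f (x t).1 - ∫ z, f z ∂π)) / Real.sqrt (((∑ i ∈ Finset.range (((∑ s ∈ Finset.range (n - 1), (if (x (s + 1)).2 then (1 : ℕ) else 0)) - 1 : ℕ)), ((∑' u, (if (∑ s ∈ Finset.range u, (if (x (s + 1)).2 then (1 : ℕ) else 0)) = i + 1 then (1 : ℝ) else 0) * f (x u).1) - ((∑ i ∈ Finset.range (((∑ s ∈ Finset.range (n - 1), (if (x (s + 1)).2 then (1 : ℕ) else 0)) - 1 : ℕ)), (∑' u, (if (∑ s ∈ Finset.range u, (if (x (s + 1)).2 then (1 : ℕ) else 0)) = i + 1 then (1 : ℝ) else 0) * f (x u).1)) / (∑ i ∈ Finset.range (((∑ s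 ∈ Finset.range (n - 1), (if (x (s + 1)).2 then (1 : ℕ) else 0)) - 1 : ℕ)), (∑' u, (if (∑ s ∈ Finset.range u, (if (x (s + 1)).2 then (1 : ℕ) else 0)) = i + 1 then (1 : ℝ) else 0)))) * (∑' u, (if (∑ s ∈ Finset.range u, (if (x (s + 1)).2 then (1 : ℕ) else 0)) = i + 1 then (1 : ℝ) else 0))) ^ 2) / (((∑ s ∈ Finset.range (n - 1), (if (x (s + 1)).2 then (1 : ℕ) else 0)) - 1 : ℕ))) / ((∑ i ∈ Finset.range (((∑ s ∈ Finset.range (n - 1), (if (x (s + 1)).2 then (1 : ℕ) else 0)) - 1 : ℕ)), (∑' u, (if (∑ s ∈ Finset.range u, (if (x (s + 1)).2 then (1 : ℕ) else 0)) = i + 1 then (1 : ℝ) else 0))) / (((∑ s ∈ Finset.range (n - 1), (if (x (s + 1)).2 then (1 : ℕ) else 0)) - 1 : ℕ)))) := fun n =>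
    (hAm n).div (Real.continuous_sqrt.measurable.comp (hSigm n))
  -- (1) the time-average CLT with limit `√σ² · Y ~ N(0, σ²)`
  have hY₁ : HasLaw (fun ω => Real.sqrt σ2 * Y ω) (gaussianReal 0 σ2.toNNReal) P' := by
    refine ⟨hY.aemeasurable.const_mul _, ?_⟩
    rw [show (fun ω => Real.sqrt σ2 * Y ω) = (fun a : ℝ => Real.sqrt σ2 * a) ∘ Y from rfl,
      ← AEMeasurable.map_map_of_aemeasurable (measurable_const_mul _).aemeasurable hY.aemeasurable,
      hY.map_eq, gaussianReal_map_const_mul, mul_zero, mul_one]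
    congr 1
    apply NNReal.coe_injective
    rw [NNReal.coe_mk, Real.coe_toNNReal _ hσ.le, Real.sq_sqrt hσ.le]
  have hclt := splitChain_timeAverage_clt κs μs (κ := κ) (ν := ν) (hmin := hmin) hπ hε0 hε hκs hf hC
    hY₁
  -- (2) `σ̂²_n → σ²` in probability (from the almost sure statement)
  have hV : TendstoInMeasure P (fun (n : ℕ) (x : ℕ → Ω × Bool) => (((∑ i ∈ Finset.range (((∑ s ∈ Finset.range (n - 1), (if (x (s + 1)).2 then (1 : ℕ) else 0)) - 1 : ℕ)), ((∑' u, (if (∑ s ∈ Finset.range u, (if (x (s + 1)).2 then (1 : ℕ) else 0)) = i + 1 then (1 : ℝ) else 0) * f (x u).1) - ((∑ i ∈ Finset.range (((∑ s ∈ Finset.range (n - 1), (if (x (s + 1)).2 then (1 : ℕ) else 0)) - 1 : ℕ)), (∑' u, (if (∑ s ∈ Finset.range u, (if (x (s + 1)).2 then (1 : ℕ) else 0)) = i + 1 then (1 : ℝ) else 0) * f (x u).1)) / (∑ i ∈ Finset.range (((∑ s ∈ Finset.range (n - 1), (if (x (s + 1)).2 then (1 : ℕ) else 0)) - 1 : ℕ)),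 (∑' u, (if (∑ s ∈ Finset.range u, (if (x (s + 1)).2 then (1 : ℕ) else 0)) = i + 1 then (1 : ℝ) else 0)))) * (∑' u, (if (∑ s ∈ Finset.range u, (if (x (s + 1)).2 then (1 : ℕ) else 0)) = i + 1 then (1 : ℝ) else 0))) ^ 2) / (((∑ s ∈ Finset.range (n - 1), (if (x (s + 1)).2 then (1 : ℕ) else 0)) - 1 : ℕ))) / ((∑ i ∈ Finset.range (((∑ s ∈ Finset.range (n - 1), (if (x (s + 1)).2 then (1 : ℕ) else 0)) - 1 : ℕ)), (∑' u, (if (∑ s ∈ Finset.range u, (if (x (s + 1)).2 then (1 : ℕ) else 0)) = i + 1 then (1 : ℝ) else 0))) / (((∑ s ∈ Finset.range (n - 1), (if (x (s + 1)).2 then (1 : ℕ) else 0)) - 1 : ℕ))))) atTop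
      (fun _ => σ2) :=
    tendstoInMeasure_of_tendsto_ae (fun n => (hSigm n).aestronglyMeasurable)
      (splitChain_sigmaHat_strongLaw κs μs (κ := κ) (ν := ν) (hmin := hmin) hπ hε0 hε hκs hf hC)
  -- (3) Slutsky with the continuous map `(a, w) ↦ a / √(max(w, σ²/4))`
  have hgc : Continuous fun p : ℝ × ℝ => p.1 / Real.sqrt (max p.2 (σ2 / 4)) := by
    refine continuous_fst.div ((continuous_snd.max continuous_const).sqrt) fun p => ?_
    exact (Real.sqrt_pos.2 (lt_max_of_lt_right (by positivity))).ne'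
  have hS := hclt.continuous_comp_prodMk_of_tendstoInMeasure_const hgc hV
    (fun n => (hSigm n).aemeasurable)
  have hS' := hS.congr (fun n => EventuallyEq.rfl) (ae_of_all _ fun ω => (by
    show Real.sqrt σ2 * Y ω / Real.sqrt (max σ2 (σ2 / 4)) = Y ω
    rw [max_eq_left (by linarith), mul_div_cancel_left₀ _ hsv]))
  -- (4) `T_n` differs from the Slutsky statistic only where `σ̂²_n < σ²/4`
  refine tendstoInDistribution_of_tendstoInMeasure_sub _ Y hS' ?_ (fun n => (hTm n).aemeasurable)
  rw [tendstoInMeasure_iff_measureReal_norm]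
  intro δ hδ
  have hV' := (tendstoInMeasure_iff_measureReal_norm.1 hV) (3 * σ2 / 4) (by positivity)
  refine squeeze_zero' (Eventually.of_forall fun n => measureReal_nonneg)
    (Eventually.of_forall fun n => ?_) hV'
  refine measureReal_mono fun x hx => ?_
  simp only [Set.mem_setOf_eq, Pi.sub_apply, Pi.zero_apply, sub_zero] at hx
  rw [Set.mem_setOf_eq]
  by_contra hcon
  rw [not_le, Real.norm_eq_abs, abs_lt] at hcon
  have hmax : max (((∑ i ∈ Finset.range (((∑ s ∈ Finset.range (n - 1), (if (x (s + 1)).2 then (1 : ℕ) else 0)) - 1 : ℕ)), ((∑' u, (if (∑ s ∈ Finset.range u, (if (x (s + 1)).2 then (1 : ℕ) else 0)) = i + 1 then (1 : ℝ) else 0) * f (x u).1) - ((∑ i ∈ Finset.range (((∑ s ∈ Finset.range (n - 1), (if (x (s + 1)).2 then (1 : ℕ) else 0)) - 1 : ℕ)), (∑' u, (if (∑ s ∈ Finset.range u, (if (x (s + 1)).2 then (1 : ℕ) else 0)) = i + 1 then (1 : ℝ) else 0) * f (x u).1)) / (∑ i ∈ Finset.range (((∑ s ∈ Finset.range (n -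 1), (if (x (s + 1)).2 then (1 : ℕ) else 0)) - 1 : ℕ)), (∑' u, (if (∑ s ∈ Finset.range u, (if (x (s + 1)).2 then (1 : ℕ) else 0)) = i + 1 then (1 : ℝ) else 0)))) * (∑' u, (if (∑ s ∈ Finset.range u, (if (x (s + 1)).2 then (1 : ℕ) else 0)) = i + 1 then (1 : ℝ) else 0))) ^ 2) / (((∑ s ∈ Finset.range (n - 1), (if (x (s + 1)).2 then (1 : ℕ) else 0)) - 1 : ℕ))) / ((∑ i ∈ Finset.range (((∑ s ∈ Finset.range (n - 1), (if (x (s + 1)).2 then (1 : ℕ) else 0)) - 1 : ℕ)), (∑' u, (if (∑ s ∈ Finset.range u, (if (x (s + 1)).2 then (1 : ℕ) else 0)) = i + 1 then (1 : ℝ) else 0))) / (((∑ s ∈ Finset.range (n - 1), (if (x (s + 1)).2 then (1 : ℕ) else 0)) - 1 : ℕ)))) (σ2 / 4) = (((∑ i ∈ Finset.range (((∑ s ∈ Finset.range (n - 1), (if (x (s + 1)).2 then (1 : ℕ) else 0)) - 1 : ℕ)), ((∑' u, (if (∑ s ∈ Finset.range u, (if (x (s + 1)).2 then (1 : ℕ)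 else 0)) = i + 1 then (1 : ℝ) else 0) * f (x u).1) - ((∑ i ∈ Finset.range (((∑ s ∈ Finset.range (n - 1), (if (x (s + 1)).2 then (1 : ℕ) else 0)) - 1 : ℕ)), (∑' u, (if (∑ s ∈ Finset.range u, (if (x (s + 1)).2 then (1 : ℕ) else 0)) = i + 1 then (1 : ℝ) else 0) * f (x u).1)) / (∑ i ∈ Finset.range (((∑ s ∈ Finset.range (n - 1), (if (x (s + 1)).2 then (1 : ℕ) else 0)) - 1 : ℕ)), (∑' u, (if (∑ s ∈ Finset.range u, (if (x (s + 1)).2 then (1 : ℕ) else 0)) = i + 1 then (1 : ℝ) else 0)))) * (∑' u, (if (∑ s ∈ Finset.range u, (if (x (s + 1)).2 then (1 : ℕ) else 0)) = i + 1 then (1 : ℝ) else 0))) ^ 2) / (((∑ s ∈ Finset.range (n - 1), (if (x (s + 1)).2 then (1 : ℕ) else 0)) - 1 : ℕ))) / ((∑ i ∈ Finset.range (((∑ s ∈ Finset.range (n - 1), (if (x (s + 1)).2 then (1 : ℕ) else 0)) - 1 : ℕ)), (∑' u, (if (∑ s ∈ Finset.range u, (if (x (s + 1)).2 then (1 : ℕ)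 else 0)) = i + 1 then (1 : ℝ) else 0))) / (((∑ s ∈ Finset.range (n - 1), (if (x (s + 1)).2 then (1 : ℕ) else 0)) - 1 : ℕ)))) := max_eq_left (by linarith [hcon.1])
  rw [hmax, sub_self, norm_zero] at hx
  exact absurd hx (not_le.2 hδ)

/-- **ASYMPTOTICALLY EXACT COVERAGE OF THE RUN'S OWN τ_int INTERVAL.**  Under the hypotheses of
`splitChain_timeAverage_studentized_clt`, for every `z > 0`:
`P̂(|(√n)⁻¹ Σ_{t<n} (f(x_t) − πf)| / σ̂_n ≤ z) → (gaussianReal 0 1)[−z, z]` — the interval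
`f̄_n ± z σ̂_n / √n` covers `π f` with probability tending to the nominal Gaussian value. -/
theorem splitChain_timeAverage_studentized_coverage {π : Measure Ω} [IsProbabilityMeasure π]
    (hπ : Kernel.Invariant κ π) (hε0 : 0 < ε) (hε : ε < 1)
    (hκs : ∀ p, κs p = (ε • ν).map (fun y : Ω => (y, true))
      + ((1 - ε) • Doeblin.residualKernel κ ν ε hmin p.1).map (fun y : Ω => (y, false)))
    {f : Ω → ℝ} (hf : Measurable f) {C : ℝ} (hC : ∀ x, |f x| ≤ C)
    (hσ : 0 < ((∫ y, (f y - ∫ z, f z ∂π) ^ 2 ∂π)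
      + 2 * ∑' k, ∫ y, (f y - ∫ z, f z ∂π) * (kop κ)^[k + 1] (fun y => f y - ∫ z, f z ∂π) y ∂π)) {z : ℝ} (hz : 0 < z) :
    Tendsto (fun n : ℕ => (Kernel.trajMeasure (X := fun _ : ℕ => Ω × Bool) μs
        (fun m : ℕ => κs.comap (fun h : (i : ↥(Finset.Iic m)) → Ω × Bool =>
          h ⟨m, Finset.mem_Iic.2 le_rfl⟩) (measurable_pi_apply _))).real
      {x | |((Real.sqrt n)⁻¹ * ∑ t ∈ Finset.range n, (f (x t).1 - ∫ z, f z ∂π)) / Real.sqrt (((∑ i ∈ Finset.range (((∑ s ∈ Finset.range (n - 1), (if (x (s + 1)).2 then (1 : ℕ) else 0)) - 1 : ℕ)), ((∑' u, (if (∑ s ∈ Finset.range u, (if (x (s + 1)).2 then (1 : ℕ) else 0)) = i + 1 then (1 : ℝ) else 0) * f (x u).1) - ((∑ i ∈ Finset.range (((∑ s ∈ Finset.range (n - 1), (if (x (s + 1)).2 then (1 : ℕ) else 0)) - 1 : ℕ)), (∑' u, (if (∑ s ∈ Finset.range u, (if (x (s + 1)).2 then (1 : ℕ) else 0)) = i +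 1 then (1 : ℝ) else 0) * f (x u).1)) / (∑ i ∈ Finset.range (((∑ s ∈ Finset.range (n - 1), (if (x (s + 1)).2 then (1 : ℕ) else 0)) - 1 : ℕ)), (∑' u, (if (∑ s ∈ Finset.range u, (if (x (s + 1)).2 then (1 : ℕ) else 0)) = i + 1 then (1 : ℝ) else 0)))) * (∑' u, (if (∑ s ∈ Finset.range u, (if (x (s + 1)).2 then (1 : ℕ) else 0)) = i + 1 then (1 : ℝ) else 0))) ^ 2) / (((∑ s ∈ Finset.range (n - 1), (if (x (s + 1)).2 then (1 : ℕ) else 0)) - 1 : ℕ))) / ((∑ i ∈ Finset.range (((∑ s ∈ Finset.range (n - 1), (if (x (s + 1)).2 then (1 : ℕ) else 0)) - 1 : ℕ)), (∑' u, (if (∑ s ∈ Finset.range u, (if (x (s + 1)).2 then (1 : ℕ) else 0)) = i + 1 then (1 : ℝ) else 0))) / (((∑ s ∈ Finset.range (n - 1), (if (x (s + 1)).2 then (1 : ℕ) else 0)) - 1 : ℕ))))| ≤ z})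
      atTop (𝓝 ((gaussianReal 0 1).real (Set.Icc (-z) z))) := by
  haveI hPI : IsProbabilityMeasure (Kernel.trajMeasure (X := fun _ : ℕ => Ω × Bool) μs
        (fun m : ℕ => κs.comap (fun h : (i : ↥(Finset.Iic m)) → Ω × Bool =>
          h ⟨m, Finset.mem_Iic.2 le_rfl⟩) (measurable_pi_apply _))) := inferInstance
  have hY : HasLaw (fun a : ℝ => a) (gaussianReal 0 1) (gaussianReal 0 1) :=
    ⟨aemeasurable_id', Measure.map_id'⟩
  have hclt := splitChain_timeAverage_studentized_clt κs μs (κ := κ) (ν := ν) (hmin := hmin) hπ hε0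
    hε hκs hf hC hσ hY
  have hE : ((gaussianReal 0 1).map (fun a : ℝ => a)) (frontier (Set.Icc (-z) z)) = 0 := by
    rw [Measure.map_id', frontier_Icc (by linarith)]
    haveI := nullSingletonClass_gaussianReal (μ := 0) one_ne_zero
    exact (Set.toFinite _).measure_zero _
  have key := ProbabilityMeasure.tendsto_measure_of_null_frontier_of_tendsto' hclt.tendsto hE
  have hset : ∀ n : ℕ, ((Kernel.trajMeasure (X := fun _ : ℕ => Ω × Bool) μs
        (fun m : ℕ => κs.comap (fun h : (i : ↥(Finset.Iic m)) → Ω × Bool =>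
          h ⟨m, Finset.mem_Iic.2 le_rfl⟩) (measurable_pi_apply _))).map
        (fun x : ℕ → Ω × Bool => ((Real.sqrt n)⁻¹ * ∑ t ∈ Finset.range n, (f (x t).1 - ∫ z, f z ∂π)) / Real.sqrt (((∑ i ∈ Finset.range (((∑ s ∈ Finset.range (n - 1), (if (x (s + 1)).2 then (1 : ℕ) else 0)) - 1 : ℕ)), ((∑' u, (if (∑ s ∈ Finset.range u, (if (x (s + 1)).2 then (1 : ℕ) else 0)) = i + 1 then (1 : ℝ) else 0) * f (x u).1) - ((∑ i ∈ Finset.range (((∑ s ∈ Finset.range (n - 1), (if (x (s + 1)).2 then (1 : ℕ) else 0)) - 1 : ℕ)), (∑' u, (if (∑ s ∈ Finset.range u, (if (x (s + 1)).2 then (1 : ℕ) else 0)) = i + 1 then (1 : ℝ) else 0) * f (x u).1)) / (∑ i ∈ Finset.range (((∑ s ∈ Finset.range (n - 1), (if (x (s + 1)).2 then (1 : ℕ) else 0)) - 1 : ℕ)), (∑' u, (if (∑ s ∈ Finset.range u, (if (x (s + 1)).2 then (1 : ℕ) else 0)) = i + 1 then (1 : ℝ) else 0)))) * (∑' u, (if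 (∑ s ∈ Finset.range u, (if (x (s + 1)).2 then (1 : ℕ) else 0)) = i + 1 then (1 : ℝ) else 0))) ^ 2) / (((∑ s ∈ Finset.range (n - 1), (if (x (s + 1)).2 then (1 : ℕ) else 0)) - 1 : ℕ))) / ((∑ i ∈ Finset.range (((∑ s ∈ Finset.range (n - 1), (if (x (s + 1)).2 then (1 : ℕ) else 0)) - 1 : ℕ)), (∑' u, (if (∑ s ∈ Finset.range u, (if (x (s + 1)).2 then (1 : ℕ) else 0)) = i + 1 then (1 : ℝ) else 0))) / (((∑ s ∈ Finset.range (n - 1), (if (x (s + 1)).2 then (1 : ℕ) else 0)) - 1 : ℕ)))))) (Set.Icc (-z) z)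
      = (Kernel.trajMeasure (X := fun _ : ℕ => Ω × Bool) μs
        (fun m : ℕ => κs.comap (fun h : (i : ↥(Finset.Iic m)) → Ω × Bool =>
          h ⟨m, Finset.mem_Iic.2 le_rfl⟩) (measurable_pi_apply _)))
        {x | |((Real.sqrt n)⁻¹ * ∑ t ∈ Finset.range n, (f (x t).1 - ∫ z, f z ∂π)) / Real.sqrt (((∑ i ∈ Finset.range (((∑ s ∈ Finset.range (n - 1), (if (x (s + 1)).2 then (1 : ℕ) else 0)) - 1 : ℕ)), ((∑' u, (if (∑ s ∈ Finset.range u, (if (x (s + 1)).2 then (1 : ℕ) else 0)) = i + 1 then (1 : ℝ) else 0) * f (x u).1) - ((∑ i ∈ Finset.range (((∑ s ∈ Finset.range (n - 1), (if (x (s + 1)).2 then (1 : ℕ) else 0)) - 1 : ℕ)), (∑' u, (if (∑ s ∈ Finset.range u, (if (x (s + 1)).2 then (1 : ℕ) else 0)) = i + 1 then (1 : ℝ) else 0) * f (x u).1)) / (∑ i ∈ Finset.range (((∑ s ∈ Finset.range (n - 1), (if (x (s + 1)).2 then (1 : ℕ) else 0)) - 1 : ℕ)), (∑' u, (if (∑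 s ∈ Finset.range u, (if (x (s + 1)).2 then (1 : ℕ) else 0)) = i + 1 then (1 : ℝ) else 0)))) * (∑' u, (if (∑ s ∈ Finset.range u, (if (x (s + 1)).2 then (1 : ℕ) else 0)) = i + 1 then (1 : ℝ) else 0))) ^ 2) / (((∑ s ∈ Finset.range (n - 1), (if (x (s + 1)).2 then (1 : ℕ) else 0)) - 1 : ℕ))) / ((∑ i ∈ Finset.range (((∑ s ∈ Finset.range (n - 1), (if (x (s + 1)).2 then (1 : ℕ) else 0)) - 1 : ℕ)), (∑' u, (if (∑ s ∈ Finset.range u, (if (x (s + 1)).2 then (1 : ℕ) else 0)) = i + 1 then (1 : ℝ) else 0))) / (((∑ s ∈ Finset.range (n - 1), (if (x (s + 1)).2 then (1 : ℕ) else 0)) - 1 : ℕ))))| ≤ z} := by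
    intro n
    rw [Measure.map_apply_of_aemeasurable (hclt.forall_aemeasurable n) measurableSet_Icc]
    congr 1
    ext x
    simp only [Set.mem_preimage, Set.mem_Icc, Set.mem_setOf_eq, abs_le]
  have key' := (ENNReal.tendsto_toReal (measure_ne_top _ (Set.Icc (-z) z))).comp key
  simp only [ProbabilityMeasure.coe_mk, Function.comp_def, hset, Measure.map_id'] at key'
  simp only [measureReal_def]
  exact key'

end StudentizedTimeAverage

end Summit.Ventures.LatticeQCDFlow.Scoring

end
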